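import Summits.CriticalPhenomena.CardyFormulaZ2.Theorems.CardyFlipRussoVoronoiHubFromSmirnovTelescope
import Summits.CriticalPhenomena.CardyFormulaZ2.Theorems.CardyFlipRussoVoronoiHubFromSmirnovStubIdentificationCovariance

/-!
# The one-arm route at a fixed mesh (Core D1; lead c3)

Line `moebius-exact-delaunay-dilation-ward` of crux `VoronoiHubFromSmirnov` (stmt-CriticalPhenomena-6433).
At a fixed mesh `δ`, with the squares `T` covering the carrier, the two attachments far from every
square, the no-void event `𝒢` implying the step-good event, and a per-square bound `b` for the
probability of the bad event of one telescoping step on `𝒢`, the window graph-crossing probability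
and the pulled-back graph-crossing probability differ by at most `μ(𝒢ᶜ) + #T · b`
(`abs_window_sub_pull_le`).  Ingredients: the endpoints of the telescoping (`hybEvent ∅` is the
window Euclidean event, `hybEvent T` the pulled-back event) and the abstract telescoping of Core A.
-/

noncomputable section

namespace Summit.CriticalPhenomena.CardyFormulaZ2.Cruxes.VoronoiHubFromSmirnov.MoebiusExactDelaunayDilationWard

open Set Metric MeasureTheory
open scoped symmDiff
open Literature.Analysis.FunctionSpaces
open Literature.Probability.LatticeModels (IsDelaunayPair)

/-! ### Endpoints of the telescoping -/

/-- Chains only use points physically in `K`; so the chain-point set may be cut by any set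
containing those points. -/
theorem adjCross_inter_iff {E : ℂ → ℂ → Prop} {K A₀ A₂ : Set ℂ} {δ : ℝ} {b W : Set ℂ}
    (hW : ∀ p : ℂ, (δ : ℂ) * p ∈ K → p ∈ W) :
    adjCross E K A₀ A₂ δ (b ∩ W) ↔ adjCross E K A₀ A₂ δ b := by
  constructor
  · exact adjCross_mono_set inter_subset_left
  · rintro ⟨N, p, hb, hK, h0, hN, hE⟩
    exact ⟨N, p, fun i => ⟨hb i, hW _ (hK i)⟩, hK, h0, hN, hE⟩

/-- With every square of the carrier switched, the hybrid chain event is the `E₂` chain event. -/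
theorem adjCross_adjHyb_iff_of_cover {S : Set (ℤ × ℤ)} {u : ℝ} {E₁ E₂ : ℂ → ℂ → Prop}
    {K A₀ A₂ : Set ℂ} {δ : ℝ} {b : Set ℂ} (hS : ∀ p : ℂ, (δ : ℂ) * p ∈ K → sqIdx u p ∈ S) :
    adjCross (adjHyb S u E₁ E₂) K A₀ A₂ δ b ↔ adjCross E₂ K A₀ A₂ δ b := by
  constructor
  · rintro ⟨N, p, hb, hK, h0, hN, hE⟩
    exact ⟨N, p, hb, hK, h0, hN, fun i =>
      (adjHyb_of_mem E₁ E₂ (Or.inl (hS _ (hK _)))).1 (hE i)⟩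
  · rintro ⟨N, p, hb, hK, h0, hN, hE⟩
    exact ⟨N, p, hb, hK, h0, hN, fun i =>
      (adjHyb_of_mem E₁ E₂ (Or.inl (hS _ (hK _)))).2 (hE i)⟩

/-- **Left endpoint**: no square switched = the window Euclidean graph crossing event. -/
theorem hybEvent_empty_eq {u : ℝ} {g : ℂ → ℂ} {V : Set ℂ} {δ : ℝ} {K A₀ A₂ : Set ℂ}
    (hKV : K ⊆ V) :
    hybEvent (∅ : Set (ℤ × ℤ)) u {b : ℂ | (δ : ℂ) * b ∈ V} g V δ K A₀ A₂ =
      {c | (PointConfig.restrict {b : ℂ | (δ : ℂ) * b ∈ V} c.1,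
        PointConfig.restrict {b : ℂ | (δ : ℂ) * b ∈ V} c.2) ∈ graphCross K A₀ A₂ δ} := by
  ext c
  simp only [hybEvent, mem_setOf_eq, adjCross_adjHyb_empty_iff, mem_graphCross_iff_adjCross]
  change adjCross (adjEuc {b : ℂ | (δ : ℂ) * b ∈ V} c) K A₀ A₂ δ (c.1 : Set ℂ) ↔
    adjCross (IsDelaunayPair ((((c.1 : Set ℂ) ∩ {b : ℂ | (δ : ℂ) * b ∈ V})) ∪
      ((c.2 : Set ℂ) ∩ {b : ℂ | (δ : ℂ) * b ∈ V}))) K A₀ A₂ δ ((c.1 : Set ℂ) ∩ {b : ℂ | (δ : ℂ) * b ∈ V})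
  rw [adjCross_inter_iff (W := {b : ℂ | (δ : ℂ) * b ∈ V}) (b := (c.1 : Set ℂ)) (fun p hp => hKV hp)]
  rfl

/-- **Right endpoint**: every square of the carrier switched = the pulled-back graph crossing event. -/
theorem hybEvent_cover_eq {S : Set (ℤ × ℤ)} {u : ℝ} {W : Set ℂ} {g : ℂ → ℂ} {V : Set ℂ} {δ : ℝ}
    {K A₀ A₂ : Set ℂ} (hS : ∀ p : ℂ, (δ : ℂ) * p ∈ K → sqIdx u p ∈ S) :
    hybEvent S u W g V δ K A₀ A₂ = hGraphCross K A₀ A₂ g V δ := by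
  ext c
  simp only [hybEvent, mem_setOf_eq, mem_hGraphCross_iff_adjCross_adjPull]
  exact adjCross_adjHyb_iff_of_cover hS

/-- **Right endpoint**, ∀-form (registered glue sub-goal of this module). -/
theorem hybEvent_cover_eq' : ∀ (S : Set (ℤ × ℤ)) (u : ℝ) (W : Set ℂ) (g : ℂ → ℂ) (V : Set ℂ) (δ : ℝ) (K A₀ A₂ : Set ℂ), (∀ p : ℂ, (δ : ℂ) * p ∈ K → sqIdx u p ∈ S) → hybEvent S u W g V δ K A₀ A₂ = hGraphCross K A₀ A₂ g V δ :=
  fun _ _ _ _ _ _ _ _ _ hS => hybEvent_cover_eq hS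

/-! ### The bound at a fixed mesh -/

/-- **The one-arm route at a fixed mesh.**  Squares of side `u > 0` indexed by `T`, outer radius
`R > 400u`, far radius `Rfar ≥ R`; `T` contains the square of every point physically in `K ⊆ V`;
every square of `T` is farther than `Rfar` from one of the two attachment sets; the event `good`
implies the step-good event; and on `good` the bad event of one step has probability `≤ b` for every
square of `T`.  Then the window Euclidean graph crossing and the pulled-back graph crossing have
probabilities within `μ(goodᶜ) + #T · b` of each other (`μ = lawBW volume`). -/
theorem abs_window_sub_pull_le {T : Finset (ℤ × ℤ)} {u R Rfar b : ℝ} {g : ℂ → ℂ} {V : Set ℂ}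
    {δ : ℝ} {K A₀ A₂ : Set ℂ} {good : Set (PointConfig ℂ × PointConfig ℂ)} (hu : 0 < u)
    (hR : 400 * u < R) (hRfar : R ≤ Rfar) (hKV : K ⊆ V)
    (hfar : ∀ i ∈ T, (∀ x : ℂ, (δ : ℂ) * x ∈ A₀ → Rfar < dist x (sqCentre u i)) ∨
      (∀ x : ℂ, (δ : ℂ) * x ∈ A₂ → Rfar < dist x (sqCentre u i)))
    (hT : ∀ p : ℂ, (δ : ℂ) * p ∈ K → sqIdx u p ∈ T)
    (hgood : good ⊆ stepGood u {b : ℂ | (δ : ℂ) * b ∈ V} g V δ K)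
    (hb : ∀ i ∈ T, (lawBW (volume : Measure ℂ)).real
      (stepBad T u R {b : ℂ | (δ : ℂ) * b ∈ V} g V δ K i ∩ good) ≤ b) :
    |(lawBW (volume : Measure ℂ)).real
        {c | (PointConfig.restrict {b : ℂ | (δ : ℂ) * b ∈ V} c.1,
          PointConfig.restrict {b : ℂ | (δ : ℂ) * b ∈ V} c.2) ∈ graphCross K A₀ A₂ δ} -
      (lawBW (volume : Measure ℂ)).real (hGraphCross K A₀ A₂ g V δ)| ≤
      (lawBW (volume : Measure ℂ)).real goodᶜ + T.card * b := by
  classical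
  haveI := isProbabilityMeasure_lawBW_volume
  set μ : Measure (PointConfig ℂ × PointConfig ℂ) := lawBW (volume : Measure ℂ) with hμ
  set Wd : Set ℂ := {b : ℂ | (δ : ℂ) * b ∈ V} with hWd
  set G : Finset (ℤ × ℤ) → Set (PointConfig ℂ × PointConfig ℂ) :=
    fun S => hybEvent (↑S : Set (ℤ × ℤ)) u Wd g V δ K A₀ A₂ with hG
  set Bad : ℤ × ℤ → Set (PointConfig ℂ × PointConfig ℂ) :=
    fun i => stepBad T u R Wd g V δ K i ∩ good with hBad
  have hstep : ∀ S : Finset (ℤ × ℤ), S ⊆ T → ∀ i ∈ T, i ∉ S →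
      (G S) ∆ (G (insert i S)) ∩ good ⊆ Bad i := by
    intro S hS i hi hiS c hc
    refine ⟨hybEvent_symmDiff_subset_stepBad hu hR hRfar hfar hT hS hi hiS ⟨hc.1, hgood hc.2⟩, hc.2⟩
  have htel := abs_measureReal_sub_le_of_steps μ T G good Bad hstep
  have h0 : G ∅ = {c | (PointConfig.restrict Wd c.1, PointConfig.restrict Wd c.2) ∈
      graphCross K A₀ A₂ δ} := by
    simp only [hG, Finset.coe_empty]
    exact hybEvent_empty_eq hKV
  have h1 : G T = hGraphCross K A₀ A₂ g V δ := by
    simp only [hG]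
    exact hybEvent_cover_eq fun p hp => Finset.mem_coe.2 (hT p hp)
  rw [h0, h1] at htel
  refine htel.trans (add_le_add_right ?_ _)
  calc ∑ i ∈ T, μ.real (Bad i) ≤ ∑ i ∈ T, b := Finset.sum_le_sum fun i hi => hb i hi
    _ = T.card * b := by rw [Finset.sum_const, nsmul_eq_mul]

end Summit.CriticalPhenomena.CardyFormulaZ2.Cruxes.VoronoiHubFromSmirnov.MoebiusExactDelaunayDilationWard

end
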